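import Summits.CriticalPhenomena.CardyFormulaZ2.Theorems.CardyQContinuationIsingJetsConformalStubHarmonicMeasureTransport
import Summits.CriticalPhenomena.CardyFormulaZ2.Theorems.CardyQContinuationIsingJetsConformalStubDiscArcHarmonic

/-!
# Crux `IsingJetsConformal`, stub `stub_loopSymmetricLimit_harmonicMeasureArcLowerBound`:
# a uniform positive minorant for the harmonic measure of a boundary set containing a fixed arc
# (route `CardyQContinuation`, item stmt-CriticalPhenomena-5560)

The "no small arcs" hypothesis of the Chelkak–Smirnov crossing theorem asks for a lower bound on
the PERRON harmonic measure `Literature.Analysis.Potential.harmonicMeasure D z A` of the wired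
arcs. For the approximating quadrilaterals of the crux this bound is obtained by transporting
the harmonic measure of a FIXED circular arc of the unit disc through the Riemann maps. This file
packages the two landed inputs

* `stub_loopSymmetricLimit_discArcHarmonic` — for `a < b < a + 2π` an explicit holomorphic `F` on
  the disc with `0 < Re F < 1`, `Re F → 1` on the open arc `(a, b)` and `Re F → 0` on the
  complementary open arc `(b, a + 2π)`;
* `stub_loopSymmetricLimit_harmonicMeasureTransport` — a holomorphic `F` with `Re F ≤ 1` and
  `Re F → 0⁺`-small near every `ζ ∈ ∂𝔻` with `Φ ζ ∉ A` satisfies `Re F (w) ≤ ω_D(f w, A)`;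

into: for each arc `[a, b]` there is ONE positive continuous `u` on the disc (namely `u = Re F`)
with `u w ≤ ω_D(f w, A)` for every Jordan domain `D`, Riemann map `f : 𝔻 → D` with Carathéodory
extension `Φ`, and every `A` containing `Φ (e^{iθ})` for all `θ ∈ [a, b]`.

Proof. Only the decay hypothesis of the transport lemma needs an argument: a point `ζ` of the
unit circle is `e^{iθ}` for a unique `θ ∈ [a, a + 2π)` (`toIcoMod` of `arg ζ`); if `Φ ζ ∉ A` then
`θ ∉ [a, b]`, so `b < θ < a + 2π` and the second limit of the disc lemma gives `Re F → 0` at `ζ`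
within the disc, whence `Re F < ε` eventually for every `ε > 0`.

References: T. Ransford, *Potential Theory in the Complex Plane* (1995), §4.3 (harmonic measure,
Perron lower bounds, harmonic measure of arcs of the disc); Ch. Pommerenke, *Boundary Behaviour
of Conformal Maps* (1992), Thm. 2.6 (Carathéodory). No named fact is used beyond the two inputs.
-/

namespace Summit.CriticalPhenomena.CardyFormulaZ2.Theorems.CardyQContinuation

open Set Metric Filter
open scoped Topology
open Literature.Analysis.Potential
open Literature.Probability.RandomPlanarGeometry

namespace HarmonicMeasureArcLowerBound

/-- **Angle representative in a prescribed window.** Every point `ζ` of the unit circle is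
`e^{iθ}` for some `θ ∈ [a, a + 2π)`: take `θ = toIcoMod (2π) a (arg ζ)`, which differs from
`arg ζ` by an integer multiple of `2π`. [folklore] -/
theorem exists_mem_Ico_exp_eq (a : ℝ) {ζ : ℂ} (hζ : ζ ∈ sphere (0 : ℂ) 1) :
    ∃ θ ∈ Set.Ico a (a + 2 * Real.pi), Complex.exp (θ * Complex.I) = ζ := by
  have h1 : ‖ζ‖ = 1 := mem_sphere_zero_iff_norm.1 hζ
  have h2 : Complex.exp (Complex.arg ζ * Complex.I) = ζ := by
    have h := Complex.norm_mul_exp_arg_mul_I ζ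
    rwa [h1, Complex.ofReal_one, one_mul] at h
  refine ⟨toIcoMod Real.two_pi_pos a (Complex.arg ζ), toIcoMod_mem_Ico _ _ _, ?_⟩
  refine (Complex.exp_eq_exp_iff_exists_int.2
    ⟨-toIcoDiv Real.two_pi_pos a (Complex.arg ζ), ?_⟩).trans h2
  rw [← self_sub_toIcoDiv_zsmul, zsmul_eq_mul]
  push_cast
  ring

/-- **Decay off the arc.** If `Re F → 0` within the disc at every `e^{iθ}` with
`b < θ < a + 2π`, and `A ∋ Φ (e^{iθ})` for all `θ ∈ [a, b]`, then at every `ζ ∈ ∂𝔻` with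
`Φ ζ ∉ A` and for every `ε > 0`, eventually `Re F < ε` within the disc near `ζ` (write
`ζ = e^{iθ}` with `θ ∈ [a, a + 2π)`; `θ ∈ [a, b]` is excluded by `Φ ζ ∉ A`). [folklore] -/
theorem eventually_re_lt {a b : ℝ} {F : ℂ → ℂ}
    (hF0 : ∀ θ : ℝ, b < θ → θ < a + 2 * Real.pi →
      Tendsto (fun w ↦ (F w).re) (𝓝[ball 0 1] (Complex.exp (θ * Complex.I))) (𝓝 0))
    {Φ : ℂ → ℂ} {A : Set ℂ}
    (hA : ∀ θ : ℝ, a ≤ θ → θ ≤ b → Φ (Complex.exp (θ * Complex.I)) ∈ A)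
    {ζ : ℂ} (hζ : ζ ∈ sphere (0 : ℂ) 1) (hζA : Φ ζ ∉ A) {ε : ℝ} (hε : 0 < ε) :
    ∀ᶠ w in 𝓝[ball 0 1] ζ, (F w).re < ε := by
  obtain ⟨θ, ⟨haθ, hθa⟩, rfl⟩ := exists_mem_Ico_exp_eq a hζ
  have hbθ : b < θ := lt_of_not_ge fun hθb ↦ hζA (hA θ haθ hθb)
  exact (hF0 θ hbθ hθa).eventually (Iio_mem_nhds hε)

/-- **From a disc arc function to the uniform lower bound.** If `F` is holomorphic on `𝔻` with
`0 < Re F < 1` and `Re F → 0` within the disc at every `e^{iθ}`, `b < θ < a + 2π`, then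
`u = Re F` is continuous and positive on `𝔻` and minorises `ω_D(f w, A)` for every Jordan domain
`D`, Riemann map `f` with Carathéodory extension `Φ`, and every `A` containing `Φ (e^{iθ})` for
`θ ∈ [a, b]` (transport lemma `stub_loopSymmetricLimit_harmonicMeasureTransport` with the decay
supplied by `eventually_re_lt`). [folklore] -/
theorem of_discArc {a b : ℝ} {F : ℂ → ℂ} (hF : DifferentiableOn ℂ F (ball 0 1))
    (hF01 : ∀ w ∈ ball (0 : ℂ) 1, 0 < (F w).re ∧ (F w).re < 1)
    (hF0 : ∀ θ : ℝ, b < θ → θ < a + 2 * Real.pi →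
      Tendsto (fun w ↦ (F w).re) (𝓝[ball 0 1] (Complex.exp (θ * Complex.I))) (𝓝 0)) :
    ∃ u : ℂ → ℝ, ContinuousOn u (ball 0 1) ∧ (∀ w ∈ ball (0 : ℂ) 1, 0 < u w) ∧
      ∀ (D : JordanDomain) (f : ConformalEquiv (ball (0 : ℂ) 1) D.carrier) (Φ : ℂ → ℂ),
        ContinuousOn Φ (closedBall 0 1) → EqOn Φ f (ball 0 1) →
        BijOn Φ (closedBall 0 1) (closure D.carrier) →
        BijOn Φ (sphere 0 1) (frontier D.carrier) →
        ∀ A : Set ℂ, (∀ θ : ℝ, a ≤ θ → θ ≤ b → Φ (Complex.exp (θ * Complex.I)) ∈ A) →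
        ∀ w ∈ ball (0 : ℂ) 1, u w ≤ harmonicMeasure D.carrier (f w) A := by
  refine ⟨fun w ↦ (F w).re, Complex.continuous_re.comp_continuousOn hF.continuousOn,
    fun w hw ↦ (hF01 w hw).1, ?_⟩
  intro D f Φ hΦc hΦf hΦbij hΦfr A hA w hw
  exact stub_loopSymmetricLimit_harmonicMeasureTransport D f Φ hΦc hΦf hΦbij hΦfr A F hF
    (fun w hw ↦ (hF01 w hw).2.le) (fun ζ hζ hζA ε hε ↦ eventually_re_lt hF0 hA hζ hζA hε) w hw

end HarmonicMeasureArcLowerBound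

open HarmonicMeasureArcLowerBound

/-- **Stub `stub_loopSymmetricLimit_harmonicMeasureArcLowerBound`** of the skeleton of the crux
`IsingJetsConformal` (stmt-CriticalPhenomena-5560): for every arc window `a < b < a + 2π` there
is one function `u : ℂ → ℝ`, continuous and positive on the unit disc, such that for every Jordan
domain `D`, conformal map `f : 𝔻 → D` with Carathéodory extension `Φ` (continuous on the closed
disc, `= f` on `𝔻`, bijective `D̄(0, 1) → D̄` and `∂𝔻 → ∂D`) and every set `A` with
`Φ (e^{iθ}) ∈ A` for all `θ ∈ [a, b]`, the Perron harmonic measure satisfies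
`u w ≤ ω_D(f w, A)` on `𝔻`. Here `u = Re F` for the disc arc function `F` of
`stub_loopSymmetricLimit_discArcHarmonic`, and the bound is
`HarmonicMeasureArcLowerBound.of_discArc`. [folklore] -/
theorem stub_loopSymmetricLimit_harmonicMeasureArcLowerBound : (∀ (a b : ℝ), a < b → b < a + 2 * Real.pi → ∃ u : ℂ → ℝ, ContinuousOn u (Metric.ball 0 1) ∧ (∀ w ∈ Metric.ball (0 : ℂ) 1, 0 < u w) ∧ ∀ (D : Literature.Probability.RandomPlanarGeometry.JordanDomain) (f : Literature.Probability.RandomPlanarGeometry.ConformalEquiv (Metric.ball (0 : ℂ) 1) D.carrier) (Φ : ℂ → ℂ), ContinuousOn Φ (Metric.closedBall 0 1) → Set.EqOn Φ f (Metric.ball 0 1) → Set.BijOn Φ (Metric.closedBall 0 1) (closure D.carrier) → Set.BijOn Φ (Metric.sphere 0 1) (frontier D.carrier) → ∀ (A : Set ℂ), (∀ θ : ℝ, a ≤ θ → θ ≤ b → Φ (Complex.exp (θ * Complex.I)) ∈ A) → ∀ w ∈ Metric.ball (0 : ℂ) 1, u w ≤ Literature.Analysis.Potential.harmonicMeasure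 D.carrier (f w) A) := by
  intro a b hab hba
  obtain ⟨F, hF, hF01, -, hF0⟩ := stub_loopSymmetricLimit_discArcHarmonic a b hab hba
  exact of_discArc hF hF01 hF0

end Summit.CriticalPhenomena.CardyFormulaZ2.Theorems.CardyQContinuation
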